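import Summits.QuantumFields.YangMills.Theorems.BalabanLadderIRFrameCells
import Literature.Probability.LatticeModels.CoarseCellFiniteSize

/-!
# The box instance of the coarse-cell defect engine for the `af-pincer-Uc` port (definitions)

Helper definitions for item `stmt-QuantumFields-19354` (crux `IR` of route `BalabanLadder`; registered line
`af-pincer-Uc`, stub `stub_typCriterionUc : TypCriterionUKPc` = the PORT of the tree engine
`Literature.Probability.LatticeModels.annealed_influence_markov_defects` under «architecture δ'» of the crux-ideate memo
`MEMO-g6-port-map.md` (seat ym-cruxidea-19354-1 g6, sha16 5801b89850437ef3; companion `Sketch-g6-port.lean` 6593698f03a93047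
§3/§5, whose definitions this file copies VERBATIM up to the namespace — the one delta is that `padConfig` is not a
constant here but a lambda inside the proof that uses it).

The engine (`CoarseCellMixingDefects*.lean`) reads a specification `γ : Specification V S` on a FINITE site type `V` through
a cell map `cell : V → CoarseIdx μc` into a coarse torus.  The instance: for a mesh-`b` frame `w : Fin 4 → ℤ → ℤ` of `ℤ⁴`
(cells `cellEdges w y`, cell-index map `frameCell w`, tree `Theorems.BalabanLadderIRFrameCells`) and a BOX of `m⁴` cells with
lowest corner `x₀`,
* `V := BoxLink w x₀ m` = the links of the box cells;
* the coarse torus has `2m + 4n + 3` labels per axis — the `m` box layers plus `m + 4n + 3` PHANTOM (link-less) layers —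
  so that cyclic windows of radius `≤ 2n + 1` around box cells never wrap onto the opposite face, the cyclic distance of
  two box labels is the `ℤ⁴` sup-distance `cellDist` of the cells, and the engine's size condition `4n + 3 ≤ μc i + 1`
  holds for every `m`;
* `boxSpec`: the kernel of a link set `A ⊆ V` in the exterior `ζ : V → G` is the `ℤ⁴` Wilson kernel
  `ymSpecification ρ β A (boxExt ζ)` of the padded configuration «`ζ` on the box, `pad` off the box», read on the box links;
* `boxGood`: a label is good iff the padded data are typical (`∈ Typ y`) on its box cell `y`; phantom labels are always
  good.
The sources of the engine are the labels of the one-cell RIND `rindCells` (nothing is assumed of the data there); the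
resampled volume is the set of links of the INNER cells `innerCells`.

Only definitions here (review lane); the instance obligations (specification axioms, block-Markov property, the
good-exterior finite-size condition from clause (i) at every centre, the uniform kernel Peierls bound from clause (ii))
and the port itself are proved in the sibling `AfPincerUcPort*.lean` files.

HONEST FRAMING: bookkeeping for one stub of one open gap-crux of a CONDITIONAL chain (Track A 0/28 UV); no claim about
the crux, the gap, infinite volume or Clay.
-/

set_option autoImplicit false

noncomputable section

open MeasureTheory
open Literature.MathematicalPhysics.QuantumLattice
open Literature.Probability.LatticeModels
open Summit.QuantumFields.YangMills.Cruxes.IR.Tempered (cellEdges regionEdges)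
open Summit.QuantumFields.YangMills.Cruxes.IR.CellTempered.Engine (frameCell)

namespace Summit.QuantumFields.YangMills.Cruxes.IR.AfPincerUc.Port

/-! ## §1 Boxes of cells in `ℤ⁴` -/

/-- The cells of the box with lowest corner `x₀` and `m` cells per side: `∏ᵢ [x₀ i, x₀ i + m)`. -/
def boxCells (x₀ : Fin 4 → ℤ) (m : ℕ) : Finset (Fin 4 → ℤ) :=
  Fintype.piFinset fun i : Fin 4 => Finset.Ico (x₀ i) (x₀ i + m)

/-- The INNER cells of the box (the box without its one-cell rind): `∏ᵢ [x₀ i + 1, x₀ i + m - 1)`.  Their links are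
the resampled volume of the port. -/
def innerCells (x₀ : Fin 4 → ℤ) (m : ℕ) : Finset (Fin 4 → ℤ) :=
  Fintype.piFinset fun i : Fin 4 => Finset.Ico (x₀ i + 1) (x₀ i + m - 1)

/-- The RIND: box cells that are not inner (the engine's source set; nothing is assumed of the data there). -/
def rindCells (x₀ : Fin 4 → ℤ) (m : ℕ) : Finset (Fin 4 → ℤ) :=
  boxCells x₀ m \ innerCells x₀ m

/-- Sup-distance of cell indices in `ℤ⁴`. -/
def cellDist (x y : Fin 4 → ℤ) : ℕ :=
  Finset.univ.sup fun i : Fin 4 => (x i - y i).natAbs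

/-! ## §2 The box instance: sites, phantom-padded coarse torus, padded kernels, good family -/

section Box

variable {G : Type} [Group G] [TopologicalSpace G] [IsTopologicalGroup G] [CompactSpace G]
  [MeasurableSpace G] [BorelSpace G]

/-- The links of the box cells. -/
def boxEdges (w : Fin 4 → ℤ → ℤ) (x₀ : Fin 4 → ℤ) (m : ℕ) : Finset (ZdEdge 4) :=
  regionEdges w (boxCells x₀ m)

/-- **Site type `V` of the box specification**: the links of the box cells (a `Fintype` with decidable equality). -/
abbrev BoxLink (w : Fin 4 → ℤ → ℤ) (x₀ : Fin 4 → ℤ) (m : ℕ) : Type :=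
  ↥(boxEdges w x₀ m)

/-- **The padded coarse torus**: `2m + 4n + 3` labels per axis (`m` box layers + `m + 4n + 3` phantom layers), given
as the engine's `μc` (labels `ZMod (μc i + 1)`). -/
def boxMod (m n : ℕ) : Fin 4 → ℕ := fun _ => 2 * m + 4 * n + 2

/-- The coarse label of the `ℤ⁴` cell `y`: `y − x₀` read modulo `2m + 4n + 3` (box cells get the labels `[0, m)⁴`). -/
def boxLabel (x₀ : Fin 4 → ℤ) (m n : ℕ) (y : Fin 4 → ℤ) : CoarseIdx (boxMod m n) :=
  fun i => ((y i - x₀ i : ℤ) : ZMod (boxMod m n i + 1))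

/-- **The cell map `cell : V → CoarseIdx μc`** of the instance: a box link carries the label of its frame cell. -/
def boxCell (w : Fin 4 → ℤ → ℤ) (x₀ : Fin 4 → ℤ) (m n : ℕ) (e : BoxLink w x₀ m) : CoarseIdx (boxMod m n) :=
  boxLabel x₀ m n (frameCell w e.1)

/-- **Extension of box data** `ζ` by the padding `pad` off the box. -/
def boxExt (w : Fin 4 → ℤ → ℤ) (x₀ : Fin 4 → ℤ) (m : ℕ) (pad : LGConfig 4 G) (ζ : BoxLink w x₀ m → G) :
    LGConfig 4 G :=
  fun e => if h : e ∈ boxEdges w x₀ m then ζ ⟨e, h⟩ else pad e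

/-- Restriction of a `ℤ⁴` configuration to the box links. -/
def boxRestrict (w : Fin 4 → ℤ → ℤ) (x₀ : Fin 4 → ℤ) (m : ℕ) (σ : LGConfig 4 G) : BoxLink w x₀ m → G :=
  fun e => σ e.1

/-- **The box specification `γ^box`**: resample the `ℤ⁴` Wilson kernel of the link set `A ⊆ V` in the exterior «box data
`ζ` inside, padding `pad` outside» and read the result on the box links.  (No torus, no Gibbs measure.) -/
def boxSpec {N : ℕ} (ρ : G →* Matrix (Fin N) (Fin N) ℂ) (β : ℝ) (w : Fin 4 → ℤ → ℤ) (x₀ : Fin 4 → ℤ) (m : ℕ)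
    (pad : LGConfig 4 G) : Specification (BoxLink w x₀ m) G :=
  fun A ζ => (ymSpecification ρ β (A.map (Function.Embedding.subtype fun e => e ∈ boxEdges w x₀ m))
    (boxExt w x₀ m pad ζ)).map (boxRestrict w x₀ m)

/-- **The good family of the instance**: a label is good iff the padded data are typical on every box cell carrying
that label (there is at most one); a PHANTOM label (carried by no box cell) is always good. -/
def boxGood (w : Fin 4 → ℤ → ℤ) (x₀ : Fin 4 → ℤ) (m n : ℕ) (pad : LGConfig 4 G)
    (Typ : (Fin 4 → ℤ) → Set (LGConfig 4 G)) : CoarseIdx (boxMod m n) → Set (BoxLink w x₀ m → G) :=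
  fun c => {ζ | ∀ y ∈ boxCells x₀ m, boxLabel x₀ m n y = c → boxExt w x₀ m pad ζ ∈ Typ y}

end Box

end Summit.QuantumFields.YangMills.Cruxes.IR.AfPincerUc.Port

end
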